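import Summits.Parity.GeneralizedHardyLittlewood.Theorems.GreenTaoLevelTwoMNTwoDichotomy

/-!
# Route `GreenTaoLevelTwo`, crux `MNTwo` (stmt-Parity-21276), line `birth`, stub `stub_mnVertical`:
# the progression sum in the `[1,L] × [1,M]` cutoff form (GT 2008b §10, proof of Lemma 24)

Glue between steps 2 and 3 of the remaining Lemma-24 assembly for `stub_mnVertical` (B. Green,
T. Tao, *Quadratic uniformity of the Möbius function*, Ann. Inst. Fourier 58 (2008) =
arXiv:math/0606087, §10: "By relabeling the `b`'s, we can write `b(d+sl) b(w+tm)` simply as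
`b(l) b(m)`. We also set `P(l,m) := (d+sl)(w+tm)`").  Def-free: the `ℕ`-indexed progression sum
produced by `…MNTwoTypeIIBasePoint.typeII_base_point` (for the `G` of
`…MNTwoTypeIIXformInt.typeII_Xform_int`) equals the `ℤ`-indexed sum
`∑_{l∈[1,L]} ∑_{m∈[1,M]} b(l) b'(m) f(l,m)` with `b(l) = b₁(d+sl)`, `b'(m) = b₂(w+tm)` and
`f(l,m) = wt(l,m)·e(φ(P(l,m)))`, `wt(l,m) = 1_{[1,L]×[1,M]}(l,m)·ψ(P(l,m))` — the input shape of
`…MNTwoTypeIISixteenfold.typeII_sixteenfold` and `…MNTwoSixteenSum.sixteen_sum_eq`.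

* `progression_sum_eq` — the statement just described;
* `cutoff_vanish` — `f` vanishes outside `[1,L] × [1,M]`.

References: [GreenTao2008QuadraticMobius] arXiv:math/0606087 §10 (proof of Lemma 24).
-/

noncomputable section

open Finset

namespace Summit.Parity.GeneralizedHardyLittlewood.GreenTaoLevelTwoMNTwoProgressionReindex

open Summit.Parity.GeneralizedHardyLittlewood.GreenTaoLevelTwoMNTwoDichotomy (map_natCast_Icc)

/-- The cutoff `f(l,m) = 1_{[1,L]×[1,M]}(l,m)·ψ(P(l,m))·e(φ(P(l,m)))` vanishes outside the box.
[folklore] -/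
theorem cutoff_vanish (ψ : ℤ → ℝ) (φ : ℤ → UnitAddCircle) (d w s t : ℤ) (L M : ℕ) :
    ∀ l m : ℤ, (l ∉ Icc (1 : ℤ) L ∨ m ∉ Icc (1 : ℤ) M) →
      (((if l ∈ Icc (1 : ℤ) L ∧ m ∈ Icc (1 : ℤ) M then ψ ((d + s * l) * (w + t * m)) else 0 :
          ℝ) : ℂ) * (AddCircle.toCircle (φ ((d + s * l) * (w + t * m))) : ℂ)) = 0 := by
  intro l m hlm
  have : ¬ (l ∈ Icc (1 : ℤ) L ∧ m ∈ Icc (1 : ℤ) M) := by tauto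
  rw [if_neg this, Complex.ofReal_zero, zero_mul]

/-- **The progression sum in cutoff form.**  See the module docstring.
[cite: GreenTao2008QuadraticMobius, §10 (proof of Lemma 24, "`P(l,m) := (d+sl)(w+tm)`")] -/
theorem progression_sum_eq (b₁ b₂ : ℤ → ℂ) (ψ : ℤ → ℝ) (φ : ℤ → UnitAddCircle)
    (d w s t : ℤ) (L M : ℕ) :
    ∑ l ∈ Icc (1 : ℕ) L, ∑ m ∈ Icc (1 : ℕ) M,
        b₂ (w + t * (m : ℤ)) * b₁ (d + s * (l : ℤ)) *
          ((((ψ ((d + s * (l : ℤ)) * (w + t * (m : ℤ))) : ℝ)) : ℂ) *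
            (AddCircle.toCircle (φ ((d + s * (l : ℤ)) * (w + t * (m : ℤ)))) : ℂ)) =
      ∑ l ∈ Icc (1 : ℤ) L, ∑ m ∈ Icc (1 : ℤ) M,
        b₁ (d + s * l) * b₂ (w + t * m) *
          ((((if l ∈ Icc (1 : ℤ) L ∧ m ∈ Icc (1 : ℤ) M then ψ ((d + s * l) * (w + t * m))
              else 0 : ℝ)) : ℂ) * (AddCircle.toCircle (φ ((d + s * l) * (w + t * m))) : ℂ)) := by
  classical
  have hL : Icc (1 : ℤ) L = (Icc 1 L).map Nat.castEmbedding := by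
    rw [map_natCast_Icc]; simp
  have hM : Icc (1 : ℤ) M = (Icc 1 M).map Nat.castEmbedding := by
    rw [map_natCast_Icc]; simp
  rw [hL, Finset.sum_map]
  refine Finset.sum_congr rfl fun l hl => ?_
  rw [hM, Finset.sum_map]
  refine Finset.sum_congr rfl fun m hm => ?_
  have hl' : (Nat.castEmbedding l : ℤ) ∈ (Icc 1 L).map Nat.castEmbedding :=
    Finset.mem_map_of_mem _ hl
  have hm' : (Nat.castEmbedding m : ℤ) ∈ (Icc 1 M).map Nat.castEmbedding :=
    Finset.mem_map_of_mem _ hm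
  rw [if_pos ⟨hl', hm'⟩]
  simp only [Nat.castEmbedding_apply]
  ring

end Summit.Parity.GeneralizedHardyLittlewood.GreenTaoLevelTwoMNTwoProgressionReindex
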